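import Summits.BirchSwinnertonDyer.BirchSwinnertonDyer.Theorems.Rank2ObservatoryRank3ConductorTotal
import Summits.BirchSwinnertonDyer.BirchSwinnertonDyer.Theorems.Rank2Observatory5077a1Certified
import Literature.NumberTheory.QuadraticFields.ImaginaryQuadraticPrescribedSplitting
import HarnessLib

set_option linter.dupNamespace false

/-!
# BirchSwinnertonDyer — rank ≥ 2 observatory: THE HEEGNER FIELD `K = ℚ(√D)` OF EVERY RANK-3
# CENSUS ROW EXISTS (the binders `K`, `hK`, `hdK` of the census headline DISCHARGED)

HONEST FRAMING: per-curve certified theorems and census instruments; no claim on BSD in rank ≥ 2.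

Unit `b2b-bsdr2-cert-2`, gen 8.  Through gen 7 the census headline
`Rank3Row.rank3_lderiv_eq_zero_of_mem` (`L′(E,1) = 0` for every one of the `9487` rank-3 curves of
conductor `< 500 000`) still quantified over an ABSTRACT number field `K` with the two structural
hypotheses `hK : IsImaginaryQuadratic K` and `hdK : d_K = D` (the row's Heegner discriminant).  They
are not analytic inputs and not literature facts: they hold because `D` is a negative fundamental
discriminant, which the row predicate `Rank3Row.check` already verifies IN THE KERNEL for every row
(`r.D < -4 ∧ isFundDiscB r.D = true`, by trial division).  This file proves the SOUNDNESS of that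
Boolean test and feeds it to the tree's construction of the quadratic field of prescribed fundamental
discriminant (`Literature.NumberTheory.QuadraticFields.Quadratic.exists_numberField_discr_eq`,
`…isTotallyComplex_of_discr_neg`):

* `squarefree_of_squarefreeB` — the trial-division test `squarefreeB` is sound;
* `isFundamental_of_isFundDiscB` — `isFundDiscB D = true`, `D ≠ 1` ⟹ `D` has fundamental shape
  (`D ≡ 1 (4)` squarefree, or `D = 4m`, `m ≡ 2,3 (4)` squarefree);
* `exists_imaginaryQuadratic_of_isFundDiscB` — for such `D < 0` an imaginary quadratic field `K` with
  `NumberField.discr K = D` EXISTS;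
* `Rank3Row.exists_heegnerField_of_mem` — hence for every census row;
* **`Rank3Row.rank3_lderiv_eq_zero_total`** — the census headline with `K`, `hK`, `hdK` GONE: for
  every `r ∈ rank3Table`, `L′(E_r,1) = 0` given only the analytic inputs `hE` (entire continuation),
  `hGZK` (Gross–Zagier–Kolyvagin over imaginary quadratic fields, the tree's named fact
  `mordellWeilRank_eq_one_of_LDerivEK_ne_zero`, quantified over the field), `hLD`
  (`L(E^{(D)},1) ≠ 0`, the two-engine numerical certificate) and the root-number dictionary `hKD`/`hR`;
* **`rank3_lderiv_eq_zero_5077a1_total`** — the flagship `5077a1` (Buhler–Gross–Zagier) in the same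
  shape, with its conductor `N = 5077` now also hypothesis-free (`conductorNorm_5077a1_total`, from the
  gen-7 census theorem `Rank3Row.conductorNorm_eq_of_mem`).

No new data; kernel cost is one `rfl` (row `0` lookup) and `decide` on `isFundDiscB (-7)`.

References: B. H. Gross, *Kolyvagin's work on modular elliptic curves*, in *L-functions and
Arithmetic*, LMS LN 153 (1991), (1.1) and Thm. 1.3 [GrossLMS1991]; D. A. Cox, *Primes of the form
x² + ny²*, 2nd ed. (2013), §5 and p. 119 [Cox2013]; H. Cohen, *A Course in Computational Algebraic
Number Theory*, GTM 138 (1993), Def. 5.1.2 [Cohen1993]; J. Buhler, B. Gross, D. Zagier,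
Math. Comp. 44 (1985) [BuhlerGrossZagier1985]; J. E. Cremona, *Algorithms for Modular Elliptic Curves*,
2nd ed. (1997), §3.1 and Tables [CremonaAlgorithms1997].
-/

open WeierstrassCurve IsDedekindDomain Literature Literature.NumberTheory.EllipticCurves

namespace Summit.BirchSwinnertonDyer.BirchSwinnertonDyer.Rank2Observatory

open RootNumber

/-! ### Soundness of the trial-division squarefreeness test -/

/-- Soundness of `squarefreeAux`: if the trial division from `k` upwards returns `true` on `0 < n`,
no `j ≥ k` has `j² ∣ n`. [folklore] -/
theorem squarefreeAux_sound {n : ℕ} (hn : 0 < n) :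
    ∀ (fuel k : ℕ), squarefreeAux n fuel k = true → ∀ j, k ≤ j → ¬ j * j ∣ n := by
  intro fuel
  induction fuel with
  | zero => intro k h; simp [squarefreeAux] at h
  | succ fuel ih =>
    intro k h j hkj hdvd
    have hle : j * j ≤ n := Nat.le_of_dvd hn hdvd
    simp only [squarefreeAux] at h
    split_ifs at h with h1 h2
    · exact absurd (lt_of_lt_of_le h1 (Nat.mul_le_mul hkj hkj)) (not_lt.mpr hle)
    · rcases Nat.eq_or_lt_of_le hkj with rfl | hlt
      · exact h2 (Nat.mod_eq_zero_of_dvd hdvd)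
      · exact ih (k + 1) h j hlt hdvd

/-- **The trial-division test `squarefreeB` is sound**: `squarefreeB n = true → Squarefree n`.
[folklore] -/
theorem squarefree_of_squarefreeB {n : ℕ} (h : squarefreeB n = true) : Squarefree n := by
  simp only [squarefreeB, Bool.and_eq_true, decide_eq_true_eq] at h
  obtain ⟨hn, haux⟩ := h
  rw [Nat.squarefree_iff_prime_squarefree]
  intro p hp hdvd
  exact squarefreeAux_sound hn n 2 haux p hp.two_le hdvd

/-! ### Soundness of the fundamental-discriminant shape test -/

/-- **`isFundDiscB` is sound**: a `D ≠ 1` passing the Boolean test has the shape of a fundamental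
discriminant — `D ≡ 1 (mod 4)` squarefree, or `D = 4m` with `m ≡ 2, 3 (mod 4)` squarefree
(Cohen 1993, Def. 5.1.2; Cremona 1997, §3.1) — in exactly the form consumed by
`Quadratic.exists_numberField_discr_eq`. [cite: Cohen1993, Def. 5.1.2] -/
theorem isFundamental_of_isFundDiscB {D : ℤ} (h : isFundDiscB D = true) (h1 : D ≠ 1) :
    (D % 4 = 1 ∧ Squarefree D ∧ D ≠ 1) ∨
      (4 ∣ D ∧ (D / 4 % 4 = 2 ∨ D / 4 % 4 = 3) ∧ Squarefree (D / 4)) := by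
  simp only [isFundDiscB, Bool.or_eq_true, Bool.and_eq_true, decide_eq_true_eq] at h
  rcases h with ⟨h4, hsf⟩ | ⟨h16, hsf⟩
  · exact Or.inl ⟨h4, Int.squarefree_natAbs.mp (squarefree_of_squarefreeB hsf), h1⟩
  · have h4 : (4 : ℤ) ∣ D := by rcases h16 with h | h <;> omega
    refine Or.inr ⟨h4, by rcases h16 with h | h <;> omega, ?_⟩
    rw [← Int.squarefree_natAbs, Int.natAbs_ediv_of_dvd h4]
    exact squarefree_of_squarefreeB hsf

/-! ### The imaginary quadratic field of discriminant `D` exists -/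

/-- **For a negative `D` of fundamental shape (`isFundDiscB D = true`) there is an imaginary quadratic
field `K` with `d_K = D`** — the quadratic field `ℚ(√D)` of the tree
(`Quadratic.exists_numberField_discr_eq`: `[K:ℚ] = 2`, `NumberField.discr K = D`), totally complex
because `d_K < 0` (`Quadratic.isTotallyComplex_of_discr_neg`, Cox p. 119). [cite: Cox2013, p. 119] -/
theorem exists_imaginaryQuadratic_of_isFundDiscB {D : ℤ} (hD : isFundDiscB D = true) (hlt : D < 0) :
    ∃ (K : Type) (_ : Field K) (_ : NumberField K),
      IsImaginaryQuadratic K ∧ NumberField.discr K = D := by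
  obtain ⟨K, _, _, h2, hd⟩ :=
    _root_.Literature.NumberTheory.QuadraticFields.Quadratic.exists_numberField_discr_eq
      (isFundamental_of_isFundDiscB hD (by omega))
  exact ⟨K, inferInstance, inferInstance,
    ⟨h2, _root_.Literature.NumberTheory.QuadraticFields.Quadratic.isTotallyComplex_of_discr_neg h2
      (hd ▸ hlt)⟩, hd⟩

/-- **The Heegner field of a checking row exists**: `r.check = true` verifies `r.D < -4` and
`isFundDiscB r.D` in the kernel, so there is an imaginary quadratic `K` with `d_K = r.D`. [folklore] -/
theorem Rank3Row.exists_heegnerField {r : Rank3Row} (h : r.check = true) :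
    ∃ (K : Type) (_ : Field K) (_ : NumberField K),
      IsImaginaryQuadratic K ∧ NumberField.discr K = r.D := by
  obtain ⟨-, -, -, -, -, -, -, -, hlt, hfd⟩ := r.check_spec h
  exact exists_imaginaryQuadratic_of_isFundDiscB hfd (by omega)

/-- **The Heegner field `K = ℚ(√D)` exists for EVERY row of the rank-3 census** (`9487` rows;
`rank3Table_check`). [cite: CremonaAlgorithms1997, §3.1] -/
theorem Rank3Row.exists_heegnerField_of_mem {r : Rank3Row} (hr : r ∈ rank3Table) :
    ∃ (K : Type) (_ : Field K) (_ : NumberField K),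
      IsImaginaryQuadratic K ∧ NumberField.discr K = r.D :=
  Rank3Row.exists_heegnerField (check_of_mem hr)

/-- Every Heegner discriminant of the census is a negative fundamental discriminant (shape form).
[cite: CremonaAlgorithms1997, §3.1] -/
theorem Rank3Row.isFundamental_D_of_mem {r : Rank3Row} (hr : r ∈ rank3Table) :
    r.D < -4 ∧ ((r.D % 4 = 1 ∧ Squarefree r.D ∧ r.D ≠ 1) ∨
      (4 ∣ r.D ∧ (r.D / 4 % 4 = 2 ∨ r.D / 4 % 4 = 3) ∧ Squarefree (r.D / 4))) := by
  obtain ⟨-, -, -, -, -, -, -, -, hlt, hfd⟩ := r.check_spec (check_of_mem hr)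
  exact ⟨hlt, isFundamental_of_isFundDiscB hfd (by omega)⟩

/-! ### The census headline with `K`, `hK`, `hdK` discharged -/

/-- **`L′(E,1) = 0` for EVERY curve of the rank-3 census (`9487` curves of conductor `< 500 000`),
with NO field binder** — the gen-7 headline `Rank3Row.rank3_lderiv_eq_zero_of_mem` applied to the
Heegner field `K = ℚ(√D)` constructed by `Rank3Row.exists_heegnerField_of_mem`.  Remaining
hypotheses, all analytic or dictionary: `hE` (entire continuation of `L(E,s)`), `hGZK`
(Gross–Zagier–Kolyvagin over imaginary quadratic fields: the tree's named fact, for every field),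
`hKD`/`hR` (local root numbers = the printed tables), `hLD` (`L(E^{(D)},1) ≠ 0`, certified numerically
by two engines per curve). Kernel-discharged so far: `hlow` (gen 4), `hw` mod `hKD`/`hR` (gen 6),
`hmin` (gen 5), `hN` (gen 7), `K`/`hK`/`hdK` (this file). [cite: GrossLMS1991, (1.1) and Thm. 1.3] -/
theorem Rank3Row.rank3_lderiv_eq_zero_total {r : Rank3Row} (hr : r ∈ rank3Table)
    (hE : WeierstrassCurve.hasEntireLFunction_rat)
    (hGZK : ∀ (K : Type) [Field K] [NumberField K],
      mordellWeilRank_eq_one_of_LDerivEK_ne_zero r.curve K)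
    (hKD : r.curve.rootNumber_eq_neg_finprod_tableLocalRootNumberAt')
    (hR : r.curve.rootNumber_eq_neg_finprod_fullTableLocalRootNumberAt)
    (hLD : (r.curve.quadraticTwist (r.D : ℚ)).entireLFunction 1 ≠ 0) :
    deriv r.curve.entireLFunction 1 = 0 := by
  obtain ⟨K, _, _, hK, hdK⟩ := Rank3Row.exists_heegnerField_of_mem hr
  exact Rank3Row.rank3_lderiv_eq_zero_of_mem hr K hE (hGZK K) hK hdK hKD hR hLD

/-- Index form of `Rank3Row.rank3_lderiv_eq_zero_total`. [cite: GrossLMS1991, (1.1) and Thm. 1.3] -/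
theorem Rank3Row.rank3_lderiv_eq_zero_total_getElem (i : ℕ) (hi : i < rank3Table.length)
    (hE : WeierstrassCurve.hasEntireLFunction_rat)
    (hGZK : ∀ (K : Type) [Field K] [NumberField K],
      mordellWeilRank_eq_one_of_LDerivEK_ne_zero (rank3Table[i]'hi).curve K)
    (hKD : (rank3Table[i]'hi).curve.rootNumber_eq_neg_finprod_tableLocalRootNumberAt')
    (hR : (rank3Table[i]'hi).curve.rootNumber_eq_neg_finprod_fullTableLocalRootNumberAt)
    (hLD : ((rank3Table[i]'hi).curve.quadraticTwist ((rank3Table[i]'hi).D : ℚ)).entireLFunction 1 ≠ 0) :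
    deriv (rank3Table[i]'hi).curve.entireLFunction 1 = 0 :=
  Rank3Row.rank3_lderiv_eq_zero_total (List.getElem_mem hi) hE hGZK hKD hR hLD

/-- **Both central values vanish, `L(E,1) = 0 ∧ L′(E,1) = 0`, for every rank-3 census curve** in the
field-free shape: `L(E,1) = 0` from the certified root number `w = −1` (functional equation, gen 6)
and `L′(E,1) = 0` from `Rank3Row.rank3_lderiv_eq_zero_total`. [cite: GrossLMS1991, (1.1) and Thm. 1.3] -/
theorem Rank3Row.lvalues_eq_zero_total {r : Rank3Row} (hr : r ∈ rank3Table)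
    (hE : WeierstrassCurve.hasEntireLFunction_rat)
    (hGZK : ∀ (K : Type) [Field K] [NumberField K],
      mordellWeilRank_eq_one_of_LDerivEK_ne_zero r.curve K)
    (hKD : r.curve.rootNumber_eq_neg_finprod_tableLocalRootNumberAt')
    (hR : r.curve.rootNumber_eq_neg_finprod_fullTableLocalRootNumberAt)
    (hLD : (r.curve.quadraticTwist (r.D : ℚ)).entireLFunction 1 ≠ 0) :
    r.curve.entireLFunction 1 = 0 ∧ deriv r.curve.entireLFunction 1 = 0 := by
  haveI := isElliptic_of_mem hr
  exact ⟨entireLFunction_one_eq_zero_of_rootNumber_eq_neg_one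
      (Rank3Row.rootNumber_eq_neg_one_of_mem hr hKD hR),
    Rank3Row.rank3_lderiv_eq_zero_total hr hE hGZK hKD hR hLD⟩

/-! ### The flagship `5077a1`, field-free and conductor-fact-free -/

/-- Row `0` of the census table is `5077a1` (definitional unfolding, kernel-checked).
[cite: CremonaAlgorithms1997, Tables] -/
theorem rank3Table_getElem?_zero : rank3Table[0]? =
    some ⟨"5077a1", 0, 0, 1, -7, 6, 5077, -7, 4792, (1, 0, 1), (2, 0, 1), (0, 2, 1)⟩ := by
  rfl

/-- The `5077a1` row is a member of the census table. [folklore] -/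
theorem row5077a1_mem :
    (⟨"5077a1", 0, 0, 1, -7, 6, 5077, -7, 4792, (1, 0, 1), (2, 0, 1), (0, 2, 1)⟩ : Rank3Row) ∈
      rank3Table :=
  List.mem_iff_getElem?.mpr ⟨0, rank3Table_getElem?_zero⟩

/-- **`N(5077a1) = 5077` with NO hypothesis** (the gen-7 census theorem
`Rank3Row.conductorNorm_eq_of_mem`: Tate's algorithm at `2`, `3` and Silverman's criterion run in the
kernel), replacing the five conductor-exponent facts `h0 h1 h2 h5 hf` of `conductorNorm_5077a1`.
[cite: BuhlerGrossZagier1985, §1] -/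
theorem conductorNorm_5077a1_total : curve5077a1.conductorNorm ℤ = 5077 := by
  rw [curve5077a1_eq_row]; exact Rank3Row.conductorNorm_eq_of_mem row5077a1_mem

/-- `−7` passes the fundamental-discriminant shape test (kernel). [folklore] -/
theorem isFundDiscB_neg_seven : isFundDiscB (-7) = true := by
  decide

/-- **The Heegner field `ℚ(√−7)` of `5077a1` exists**: an imaginary quadratic `K` with `d_K = −7`.
[cite: BuhlerGrossZagier1985, §2] -/
theorem exists_heegnerField_5077a1 :
    ∃ (K : Type) (_ : Field K) (_ : NumberField K),
      IsImaginaryQuadratic K ∧ NumberField.discr K = -7 :=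
  exists_imaginaryQuadratic_of_isFundDiscB isFundDiscB_neg_seven (by norm_num)

/-- **`5077a1` (Buhler–Gross–Zagier): `L′(E,1) = 0` EXACTLY, field-free** — the theorem
`rank3_lderiv_eq_zero_5077a1` with `K`/`hK`/`hdK` supplied by `exists_heegnerField_5077a1`, `hmin` by
`isGloballyMinimal_curve5077a1`, `hN` by `conductorNorm_5077a1_total` (no conductor facts), `hlow` by
the kernel rank certificate and `hw` by the kernel root-number certificate (mod `hKD`).  Remaining:
`hE`, `hGZK` (for every field), `hKD`, `hLD : L(E^{(−7)},1) ≠ 0`.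
[cite: GrossLMS1991, (1.1) and Thm. 1.3] [cite: BuhlerGrossZagier1985, §2] -/
theorem rank3_lderiv_eq_zero_5077a1_total (hE : WeierstrassCurve.hasEntireLFunction_rat)
    (hGZK : ∀ (K : Type) [Field K] [NumberField K],
      mordellWeilRank_eq_one_of_LDerivEK_ne_zero curve5077a1 K)
    (hKD : curve5077a1.rootNumber_eq_neg_finprod_tableLocalRootNumberAt')
    (hLD : (curve5077a1.quadraticTwist (-7 : ℚ)).entireLFunction 1 ≠ 0) :
    deriv curve5077a1.entireLFunction 1 = 0 := by
  obtain ⟨K, _, _, hK, hdK⟩ := exists_heegnerField_5077a1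
  exact rank3_lderiv_eq_zero_5077a1 K hE (hGZK K) isGloballyMinimal_curve5077a1
    conductorNorm_5077a1_total hK hdK three_le_rank_5077a1 (rootNumber_5077a1 hKD) hLD

/-- **`5077a1`: both central values vanish**, `L(E,1) = 0 ∧ L′(E,1) = 0`, field-free.
[cite: BuhlerGrossZagier1985, §2] -/
theorem lvalues_eq_zero_5077a1_total (hE : WeierstrassCurve.hasEntireLFunction_rat)
    (hGZK : ∀ (K : Type) [Field K] [NumberField K],
      mordellWeilRank_eq_one_of_LDerivEK_ne_zero curve5077a1 K)
    (hKD : curve5077a1.rootNumber_eq_neg_finprod_tableLocalRootNumberAt')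
    (hLD : (curve5077a1.quadraticTwist (-7 : ℚ)).entireLFunction 1 ≠ 0) :
    curve5077a1.entireLFunction 1 = 0 ∧ deriv curve5077a1.entireLFunction 1 = 0 :=
  ⟨entireLFunction_one_5077a1_rn hKD, rank3_lderiv_eq_zero_5077a1_total hE hGZK hKD hLD⟩

end Summit.BirchSwinnertonDyer.BirchSwinnertonDyer.Rank2Observatory
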